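import Summits.QuantumFields.YangMills.Theorems.BalabanUVNodesN09AveragingOpenAtSmallFields
import Summits.QuantumFields.YangMills.Theorems.BalabanUVNodesN09BackgroundRadiiTransfer

/-!
# NODE N09 [B12] — N07's INTERIORITY SENTENCE IS A THEOREM OF THE TWO-RADII BINDERS ([B11] Thm 1 at `εbg` + the (8)-membership clause);
# hence `hcrit` (Sel edition) from EXACTLY the displayed binder list of the two-radii doors + numerics

Cell `pub-ymgap` (YM-PLAN Track A), seat `pub-ymgap-dag-n09-w1` g6 (D-0149 width seat 1 of node N09 [B12] = [Balaban1987RG1]); count-neutral helper of the K1-face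
(`--supports stmt-QuantumFields-27364 --as helper`).  [I] = [Balaban1987RG1] (CMP 109), [B11] = [Balaban1985Variational] (CMP 102), [B7] = [Balaban1985Averaging].

WHY.  This seat's `…N09SelectorContinuousOfUniqueOrbit` + `…N09AveragingOpenAtSmallFields` (same generation) prove that the offered selector `UkSel` and the
critical configuration `critCfgSelOfRecord` are continuous — the (F1) tower's `hcrit` binder in the `Sel` edition — from three displayed inputs at the cut-off's
radius `e = ν.εreg`: (E) the open-class fibre `bgReg e ∩ 𝔅_k(V)` is non-empty, (I) N07's INTERIORITY sentence «every minimiser over `closure (bgReg e) ∩ 𝔅_k(V)` lies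
in `bgReg e`» (`…N07DirectMethodInduction`'s `hint`, Prop. 7 (ii) species) and (U) [B11]'s uniqueness at radius `e`.  The N09 doors of record, however, display [B11]
Thm 1 in the TWO-RADII form of dag-n09-w1 g2 (`…N09BackgroundRadiiTransfer`): `h11 : UkExists … εbg V ∧ UniqueUkOrbit … εbg V` at the BACKGROUND radius `εbg` and the
(8)-membership clause `hreg8 : Uk … εbg V ∈ bgReg … ν.εreg` ([B11] Thm 1 (8): «the minimal orbit lies in 𝔘_k(B₃ε₁)», `B₃ε₁ < ε₀`).  THIS FILE shows that (E), (U) AND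
THE INTERIORITY (I) at radius `ν.εreg` FOLLOW from `h11 ∧ hreg8` as soon as `ν.εreg < εbg`: a closed-class minimiser `U_c` at radius `εreg` competes with the
radius-`εbg` minimiser `U_k^{(εbg)}(V)`, which by (8) lies in `bgReg εreg ⊆ closure (bgReg εreg)`; so `A(U_c) = A(U_k^{(εbg)}(V))`, `U_c` minimises over `bgReg εbg ⊇
closure (bgReg εreg)` (dag-n09-w1 g2 `isBackground_superset_of_exists_mem`, N07 `closure_bgReg_subset_bgReg`), hence lies on the UNIQUE radius-`εbg` minimal orbit, hence
(plaquette classes are gauge-stable) in `bgReg εreg`.  So the tower's `hcrit` (Sel edition) costs EXACTLY the binder list the two-radii doors already display, plus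
numerics.

WHAT IS PROVED (theorems only, 0 `def`, 0 `sorry`).
§1 ★★ `interior_of_thm1_of_reg8` — (I) at radius `e` from `UkExists ∧ UniqueUkOrbit` at `εbg`, `Uk … εbg V ∈ bgReg … e`, `e < εbg` (pointwise in `V`) · `openFibre_nonempty_of_reg8` ((E)) ·
   (U) is dag-n09-w1 g2's `uniqueUkOrbit_of_le_of_Uk_mem` (cited).
§2 ★★★ `continuousOn_UkSel_of_thm1_of_reg8` — `UkSel F N K k ν.εreg` continuous on any `D` carrying `h11`-at-`εbg` + `hreg8`, for `ν.εreg < εbg`, `ν.εreg < α₀` ((53)-numerics +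
   the two loop-guard numerics), `k ≤ m + K`; ★★★ `continuousOn_critCfgSelOfRecord_of_thm1_of_reg8`.
§3 ★★★ `hcritSel_domAlt_of_thm1_εbg_of_reg8` — THE TOWER'S `hcrit`, Sel EDITION, FROM THE TWO-RADII DOORS' BINDERS VERBATIM:
   `h11 : ∀ k ≤ K, ∀ V ∈ domAlt_k, UkExists … εbg V ∧ UniqueUkOrbit … εbg V`, `hreg8 : ∀ k ≤ K, ∀ V ∈ domAlt_k, Uk … εbg V ∈ bgReg … ν.εreg` (dag-n09-w1 g2's shapes), `ν.εreg < εbg`,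
   numerics ⟹ `∀ j < K, ContinuousOn (critCfgSelOfRecord F N ν K j) (domAltOfRecord F N ν K (j+1))`.
§4 ★★ `continuousWithinAt_UkSel_of_localSelector` ∕ `continuousOn_UkSel_of_selector` — the Berge-free door print's route opens ([B11] Prop. 9): a continuous local selection
   of minimisers + unique minimal orbit ⟹ `UkSel = rootGauge k ∘ s` continuous (no compactness ∕ interiority ∕ openness).

HONEST FRAMING.  Count-neutral kernel bookkeeping + the two landed topology files BY NAME; [B11] Thm 1 (`h11` at `εbg`, the (8)-clause `hreg8`) stays DISPLAYED (N07's content;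
`hreg8` is itself a theorem of N07's Thm-1 slot at objects for print-admissible radii, dag-n09-w1 g2 `…N09BackgroundRadiiReg8OfThm1Objects`); the numerics are displayed
smallness conditions; NO carrier re-pointed (the record's `critCfgOfRecord` still reads the bare `Uk` — `hcrit` is supplied for the OFFER `UkSel` only); `hreg` ∕ N09 NOT discharged;
conjunct 1 (Lemma 4) ∕ FLAG №7 untouched; K0⁷ ∕ K1⁹ ∕ K3⁸ NOT closed; counts unmoved (typed 28∕28 · discharged 5∕28); one finite four-torus programme at fixed `ε = L^{−K}` per run —
R4 closes the conditional rung `BalabanLadder.UV` only; NOT ℝ⁴ ∕ infinite volume ∕ OS; the Yang–Mills mass gap (Clay) is NOT proved by any of this.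
-/

noncomputable section

open scoped Topology
open Set Filter

namespace Summit.QuantumFields.YangMills.BalabanUVNodes.N09SelectorContinuousOfThm1TwoRadii

open Literature.MathematicalPhysics.QuantumFieldTheory.Balaban1983to89
open Literature.MathematicalPhysics.QuantumFieldTheory.Balaban1983to89.T4Continuum (T4Family)
open Literature.MathematicalPhysics.QuantumFieldTheory.Balaban1983to89.ExpMeanLog (deltaSU)
open Literature.MathematicalPhysics.QuantumFieldTheory.Balaban1983to89.Node00
open Summit.QuantumFields.YangMills.BalabanUVNodes.N07DirectMethod (closure_bgReg_subset_bgReg)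
open Summit.QuantumFields.YangMills.BalabanUVNodes.N09BackgroundRadiiTransfer
  (isBackground_superset_of_exists_mem mem_bgReg_iff_of_orbitRel uniqueUkOrbit_of_le_of_Uk_mem)
open Summit.QuantumFields.YangMills.BalabanUVNodes.N09AveragingOpenAtSmallFields
  (continuousOn_UkSel_of_uniqueOrbit' continuousOn_critCfgSelOfRecord_of_uniqueOrbit')

variable {F : T4Family} {N : ℕ} [NeZero N]

/-! ## §1 Interiority, open-class solvability and uniqueness at the cut-off's radius from [B11] Thm 1 at `εbg` + the (8)-clause -/

/-- ★★ **N07's INTERIORITY SENTENCE FROM THE TWO-RADII BINDERS.**  If the level-`k` problem at `V` is solvable at the background radius `εbg` with a UNIQUE minimal orbit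
(`UkExists ∧ UniqueUkOrbit` at `εbg` — [B11] Thm 1), the chosen minimiser lies in the smaller class `bgReg e` ((8)-membership), and `e < εbg`, then EVERY minimiser of the
Wilson action over the CLOSED class `closure (bgReg e) ∩ 𝔅_k(V)` lies in the OPEN class `bgReg e`. [cite: Balaban1985Variational, Thm 1 (6) and (8) p.279, Prop. 7 p.299] -/
theorem interior_of_thm1_of_reg8 {K k : ℕ} {e εbg : ℝ} (hlt : e < εbg) {V : GaugeField (F.P K) k (SU N)}
    (hex : UkExists F N K k εbg V) (huniq : UniqueUkOrbit F N K k εbg V) (hreg8 : Uk F N K k εbg V ∈ bgReg F N K k e) :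
    ∀ U₀ : GaugeField (F.P K) 0 (SU N), IsBackground (avOfRecord F N K) (closure (bgReg F N K k e)) k V U₀ → U₀ ∈ bgReg F N K k e := by
  intro U₀ h₀
  -- the closed class at radius `e` sits inside the open class at radius `εbg`
  have hsub : closure (bgReg F N K k e) ⊆ bgReg F N K k εbg := closure_bgReg_subset_bgReg K k hlt
  -- `U₀` is then a radius-`εbg` minimiser (it competes with `U_k^{(εbg)}(V) ∈ bgReg e ⊆ closure (bgReg e)`)
  have hbg : IsBackground (avOfRecord F N K) (bgReg F N K k εbg) k V U₀ :=
    isBackground_superset_of_exists_mem h₀ hsub (isBackground_Uk hex) (subset_closure hreg8)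
  -- … on the unique minimal orbit, which meets (hence lies in) `bgReg e`
  exact (mem_bgReg_iff_of_orbitRel (huniq _ _ hbg (isBackground_Uk hex))).2 hreg8

/-- **(E) AT THE CUT-OFF's RADIUS**: the open-class fibre `bgReg e ∩ 𝔅_k(V)` is non-empty — it contains `U_k^{(εbg)}(V)` by the (8)-clause.
[cite: Balaban1985Variational, Thm 1 (8) p.279] -/
theorem openFibre_nonempty_of_reg8 {K k : ℕ} {e εbg : ℝ} {V : GaugeField (F.P K) k (SU N)}
    (hex : UkExists F N K k εbg V) (hreg8 : Uk F N K k εbg V ∈ bgReg F N K k e) :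
    ∃ U ∈ bgReg F N K k e, Averaging.iter (avOfRecord F N K) k U = V :=
  ⟨Uk F N K k εbg V, hreg8, iter_Uk hex⟩

/-! ## §2 The selector and the critical configuration are continuous from the two-radii binders + numerics -/

/-- ★★★ **`UkSel` AT THE CUT-OFF's RADIUS IS CONTINUOUS FROM [B11] THM 1 AT `εbg` + (8) + NUMERICS**: on every set `D` of level-`k` data carrying `UkExists ∧ UniqueUkOrbit` at
`εbg` and the (8)-membership `Uk … εbg V ∈ bgReg … e`, with `e < εbg`, `e < α₀` (`α₀` admissible as in (53) plus the loop-guard numerics), `k ≤ m + K`: `ContinuousOn (UkSel F N K k e) D`.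
[cite: Balaban1985Variational, Thm 1 p.279 and (181) p.307; Balaban1987RG1, (0.21) p.256] -/
theorem continuousOn_UkSel_of_thm1_of_reg8 (K k : ℕ) {e εbg α₀ : ℝ} (hlt : e < εbg) (he : e < α₀) (hα : 0 < α₀)
    (hα3 : (143 * (((((F.P K).d + 4 : ℕ) : ℝ)) ^ 2 / 4) ^ 2) * α₀ ≤ 1 / 3)
    (hα2 : 2 * α₀ ≤ 2 * deltaSU (Fin N) / ((((F.P K).d + 4) * (F.P K).L : ℕ) : ℝ) ^ 2)
    (hα24 : ((((F.P K).d + 2) * (F.P K).L : ℕ) : ℝ) ^ 2 / 4 * (2 * α₀) ≤ 1 / 24)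
    (hαL : 157 * (((((F.P K).d + 2) * (F.P K).L : ℕ) : ℝ) ^ 2 / 4 * (2 * α₀)) < (((F.P K).L : ℝ) ^ ((F.P K).d - 1))⁻¹)
    (hk : k ≤ (F.P K).m + (F.P K).K) {D : Set (GaugeField (F.P K) k (SU N))}
    (h11 : ∀ V ∈ D, UkExists F N K k εbg V ∧ UniqueUkOrbit F N K k εbg V)
    (hreg8 : ∀ V ∈ D, Uk F N K k εbg V ∈ bgReg F N K k e) :
    ContinuousOn (UkSel F N K k e) D :=
  continuousOn_UkSel_of_uniqueOrbit' K k he hα hα3 hα2 hα24 hαL hk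
    (fun V hV => openFibre_nonempty_of_reg8 (h11 V hV).1 (hreg8 V hV))
    (fun V hV => interior_of_thm1_of_reg8 hlt (h11 V hV).1 (h11 V hV).2 (hreg8 V hV))
    (fun V hV => uniqueUkOrbit_of_le_of_Uk_mem hlt.le (h11 V hV).1 (hreg8 V hV) (h11 V hV).2)

/-- ★★★ **THE CRITICAL CONFIGURATION (Sel edition) IS CONTINUOUS FROM THE TWO-RADII BINDERS + NUMERICS** on every set `D` of level-`(k+1)` data carrying them at the
cut-off's radius `ν.εreg < εbg`. [cite: Balaban1987RG1, (2.3) p.265; Balaban1985Variational, Thm 1 p.279] -/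
theorem continuousOn_critCfgSelOfRecord_of_thm1_of_reg8 (ν : Stage7Numerics) (K k : ℕ) {εbg α₀ : ℝ} (hlt : ν.εreg < εbg) (he : ν.εreg < α₀) (hα : 0 < α₀)
    (hα3 : (143 * (((((F.P K).d + 4 : ℕ) : ℝ)) ^ 2 / 4) ^ 2) * α₀ ≤ 1 / 3)
    (hα2 : 2 * α₀ ≤ 2 * deltaSU (Fin N) / ((((F.P K).d + 4) * (F.P K).L : ℕ) : ℝ) ^ 2)
    (hα24 : ((((F.P K).d + 2) * (F.P K).L : ℕ) : ℝ) ^ 2 / 4 * (2 * α₀) ≤ 1 / 24)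
    (hαL : 157 * (((((F.P K).d + 2) * (F.P K).L : ℕ) : ℝ) ^ 2 / 4 * (2 * α₀)) < (((F.P K).L : ℝ) ^ ((F.P K).d - 1))⁻¹)
    (hk : k + 1 ≤ (F.P K).m + (F.P K).K) {D : Set (GaugeField (F.P K) (k + 1) (SU N))}
    (h11 : ∀ W ∈ D, UkExists F N K (k + 1) εbg W ∧ UniqueUkOrbit F N K (k + 1) εbg W)
    (hreg8 : ∀ W ∈ D, Uk F N K (k + 1) εbg W ∈ bgReg F N K (k + 1) ν.εreg) :
    ContinuousOn (critCfgSelOfRecord F N ν K k) D :=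
  continuousOn_critCfgSelOfRecord_of_uniqueOrbit' ν K k he hα hα3 hα2 hα24 hαL hk
    (fun W hW => openFibre_nonempty_of_reg8 (h11 W hW).1 (hreg8 W hW))
    (fun W hW => interior_of_thm1_of_reg8 hlt (h11 W hW).1 (h11 W hW).2 (hreg8 W hW))
    (fun W hW => uniqueUkOrbit_of_le_of_Uk_mem hlt.le (h11 W hW).1 (hreg8 W hW) (h11 W hW).2)

/-! ## §3 The tower's `hcrit`, Sel edition, from the two-radii doors' binders verbatim -/

/-- ★★★ **dag-n09-w1 g5's TOWER BINDER `hcrit`, Sel EDITION, FROM THE TWO-RADII DOORS' BINDERS**: with dag-n09-w1 g2's displayed shapes `h11` ([B11] Thm 1 ×2 at the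
background radius `εbg`, every level `k ≤ K`, on the small-field domains) and `hreg8` (the (8)-membership clause), the radii ordering `ν.εreg < εbg`, and numerics
(`ν.εreg < α₀`, `α₀` admissible as in (53), the two loop-guard conditions on `2α₀`): `∀ j < K, ContinuousOn (critCfgSelOfRecord F N ν K j) (domAltOfRecord F N ν K (j+1))`.
Standing range from `(F.P K).K = K`, `1 ≤ (F.P K).m`. [cite: Balaban1987RG1, (2.3) p.265 and p.259; Balaban1985Variational, Thm 1 (6), (8) p.279] -/
theorem hcritSel_domAlt_of_thm1_εbg_of_reg8 (ν : Stage7Numerics) (εbg : ℝ) (K : ℕ) {α₀ : ℝ} (hlt : ν.εreg < εbg) (he : ν.εreg < α₀) (hα : 0 < α₀)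
    (hα3 : (143 * (((((F.P K).d + 4 : ℕ) : ℝ)) ^ 2 / 4) ^ 2) * α₀ ≤ 1 / 3)
    (hα2 : 2 * α₀ ≤ 2 * deltaSU (Fin N) / ((((F.P K).d + 4) * (F.P K).L : ℕ) : ℝ) ^ 2)
    (hα24 : ((((F.P K).d + 2) * (F.P K).L : ℕ) : ℝ) ^ 2 / 4 * (2 * α₀) ≤ 1 / 24)
    (hαL : 157 * (((((F.P K).d + 2) * (F.P K).L : ℕ) : ℝ) ^ 2 / 4 * (2 * α₀)) < (((F.P K).L : ℝ) ^ ((F.P K).d - 1))⁻¹)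
    (h11 : ∀ k, k ≤ K → ∀ V ∈ domAltOfRecord F N ν K k, UkExists F N K k εbg V ∧ UniqueUkOrbit F N K k εbg V)
    (hreg8 : ∀ k, k ≤ K → ∀ V ∈ domAltOfRecord F N ν K k, Uk F N K k εbg V ∈ bgReg F N K k ν.εreg) :
    ∀ j < K, ContinuousOn (critCfgSelOfRecord F N ν K j) (domAltOfRecord F N ν K (j + 1)) := by
  intro j hj
  have hk : j + 1 ≤ (F.P K).m + (F.P K).K := by
    rw [T4Family.P_K]
    have := (F.P K).m
    omega
  exact continuousOn_critCfgSelOfRecord_of_thm1_of_reg8 ν K j hlt he hα hα3 hα2 hα24 hαL hk (h11 (j + 1) hj) (hreg8 (j + 1) hj)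

/-- **The selector's continuity on every small-field domain, same inputs**: `∀ k ≤ K, ContinuousOn (UkSel F N K k ν.εreg) (domAltOfRecord F N ν K k)`.
[cite: Balaban1985Variational, Thm 1 (6), (8) p.279 and (181) p.307] -/
theorem continuousOn_UkSel_domAlt_of_thm1_εbg_of_reg8 (ν : Stage7Numerics) (εbg : ℝ) (K : ℕ) {α₀ : ℝ} (hlt : ν.εreg < εbg) (he : ν.εreg < α₀) (hα : 0 < α₀)
    (hα3 : (143 * (((((F.P K).d + 4 : ℕ) : ℝ)) ^ 2 / 4) ^ 2) * α₀ ≤ 1 / 3)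
    (hα2 : 2 * α₀ ≤ 2 * deltaSU (Fin N) / ((((F.P K).d + 4) * (F.P K).L : ℕ) : ℝ) ^ 2)
    (hα24 : ((((F.P K).d + 2) * (F.P K).L : ℕ) : ℝ) ^ 2 / 4 * (2 * α₀) ≤ 1 / 24)
    (hαL : 157 * (((((F.P K).d + 2) * (F.P K).L : ℕ) : ℝ) ^ 2 / 4 * (2 * α₀)) < (((F.P K).L : ℝ) ^ ((F.P K).d - 1))⁻¹)
    (h11 : ∀ k, k ≤ K → ∀ V ∈ domAltOfRecord F N ν K k, UkExists F N K k εbg V ∧ UniqueUkOrbit F N K k εbg V)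
    (hreg8 : ∀ k, k ≤ K → ∀ V ∈ domAltOfRecord F N ν K k, Uk F N K k εbg V ∈ bgReg F N K k ν.εreg) :
    ∀ k, k ≤ K → ContinuousOn (UkSel F N K k ν.εreg) (domAltOfRecord F N ν K k) := by
  intro k hkK
  have hk : k ≤ (F.P K).m + (F.P K).K := by
    rw [T4Family.P_K]
    have := (F.P K).m
    omega
  exact continuousOn_UkSel_of_thm1_of_reg8 K k hlt he hα hα3 hα2 hα24 hαL hk (h11 k hkK) (hreg8 k hkK)

/-! ## §4 The Berge-free door: a continuous local selection of minimisers + uniqueness ⇒ `UkSel` continuous ([B11] Prop. 9 species) -/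

/-- ★★ **`UkSel` IS CONTINUOUS WHEREVER THE MINIMISERS ADMIT A CONTINUOUS LOCAL SELECTION AND THE MINIMAL ORBIT IS UNIQUE** — the door print's own route opens
([B11] Prop. 9 p. 309: the minimiser in a fixed gauge depends analytically on `V`): if near `V₀` within `D` some selection `s` of (0.21) minimisers at radius `e` is continuous
at `V₀` within `D`, and the minimal orbit is unique there, then `UkSel F N K k e = rootGauge k ∘ s` near `V₀` (canonicity, `Node00.rootGauge_eq_UkSel_of_isBackground`) is
continuous at `V₀` within `D` (the rooted gauge is continuous, `…N09SelectorContinuousOfUniqueOrbit.continuous_rootGauge`).  No compactness, no interiority, no openness.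
[cite: Balaban1985Variational, Prop. 9 p.309, Thm 1 p.279 and (181) p.307] -/
theorem continuousWithinAt_UkSel_of_localSelector {K k : ℕ} {e : ℝ} (hk : k ≤ (F.P K).m + (F.P K).K) {D : Set (GaugeField (F.P K) k (SU N))}
    {V₀ : GaugeField (F.P K) k (SU N)} (hV₀ : V₀ ∈ D) {s : GaugeField (F.P K) k (SU N) → GaugeField (F.P K) 0 (SU N)} (hs : ContinuousWithinAt s D V₀)
    (hsel : ∀ᶠ V in 𝓝[D] V₀, IsBackground (avOfRecord F N K) (bgReg F N K k e) k V (s V))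
    (huniq : ∀ᶠ V in 𝓝[D] V₀, UniqueUkOrbit F N K k e V) :
    ContinuousWithinAt (UkSel F N K k e) D V₀ := by
  have heq : ∀ᶠ V in 𝓝[D] V₀, T4RootedResidualGauge.rootGauge k (s V) = UkSel F N K k e V := by
    filter_upwards [hsel, huniq] with V hV hu
    exact rootGauge_eq_UkSel_of_isBackground hk hu hV
  have h₀ : T4RootedResidualGauge.rootGauge k (s V₀) = UkSel F N K k e V₀ :=
    rootGauge_eq_UkSel_of_isBackground hk (huniq.self_of_nhdsWithin hV₀) (hsel.self_of_nhdsWithin hV₀)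
  have hcomp : ContinuousWithinAt (fun V => T4RootedResidualGauge.rootGauge k (s V)) D V₀ :=
    (N09SelectorContinuousOfUniqueOrbit.continuous_rootGauge k).continuousAt.comp_continuousWithinAt hs
  exact (hcomp.congr_of_eventuallyEq (heq.mono fun V hV => hV.symm) h₀.symm)

/-- The same on a set: a selection `s` of radius-`e` minimisers continuous ON `D`, with unique minimal orbits on `D` ⟹ `ContinuousOn (UkSel F N K k e) D`.
[cite: Balaban1985Variational, Prop. 9 p.309, Thm 1 p.279] -/
theorem continuousOn_UkSel_of_selector {K k : ℕ} {e : ℝ} (hk : k ≤ (F.P K).m + (F.P K).K) {D : Set (GaugeField (F.P K) k (SU N))}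
    {s : GaugeField (F.P K) k (SU N) → GaugeField (F.P K) 0 (SU N)} (hs : ContinuousOn s D)
    (hsel : ∀ V ∈ D, IsBackground (avOfRecord F N K) (bgReg F N K k e) k V (s V)) (huniq : ∀ V ∈ D, UniqueUkOrbit F N K k e V) :
    ContinuousOn (UkSel F N K k e) D :=
  fun V₀ hV₀ => continuousWithinAt_UkSel_of_localSelector hk hV₀ (hs V₀ hV₀)
    (eventually_mem_nhdsWithin.mono fun V hV => hsel V hV) (eventually_mem_nhdsWithin.mono fun V hV => huniq V hV)

end Summit.QuantumFields.YangMills.BalabanUVNodes.N09SelectorContinuousOfThm1TwoRadii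

end
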